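import Summits.HubbardSuperconductivity.HubbardSuperconductivity.Theses.KkFloor
import Summits.HubbardSuperconductivity.HubbardSuperconductivity.Theorems.TwTipContinuation.Negative.SeededChords
import Literature.Analysis.Matrix.ZenoShelfLimit

/-!
# Route `KkFloor` — support `KkShelfNeedsVacuumGap` (stmt-HubbardSuperconductivity-10409):
# the pointwise Zeno limit

Item: at fixed `(U, δ, ε, Y, L)`, if every `(N_L, S^z = 0)`-sector eigenvalue of
`H_L + i y L⁻² Δ_dᴴ Δ_d` (`H_L = hubbardTorus 2 L 1 U`, `Δ_d = pairField dWaveFormFactor L`) has real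
part `≥ E₀(L) + ε L²` for all `y ≥ Y`, then every normalised sector vector `φ` with `Δ_d φ = 0`
has `Re ⟨φ, H_L φ⟩ ≥ E₀(L) + ε L²` (`E₀(L) = minEnergyOn H_L (szSector N_L 0)`).  This makes the
route's crux `KkPairVacuumGap` a genuine kill test for `KkZenoShelf`.

* `re_rayleigh_ge_of_shelf_sector` — the abstract Zeno limit
  `Literature.Analysis.Matrix.re_rayleigh_ge_of_shelf` (`Literature/Analysis/Matrix/ZenoShelfLimit.lean`,
  Kato's reduction) transported to an invariant coordinate sector
  (extension by zero / restriction, the pattern of `QLattice.sector_groundState`).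
* `kkShelfNeedsVacuumGap_proof` — the item: `H_L` and `L⁻² Δ_dᴴ Δ_d` are Hermitian and
  `(N↑, N↓)`-block diagonal (`PreservesSectors`, `Theorems/TwTipContinuation/Negative/SeededChords`),
  `szSector (2n) 0` is the `(n, n)` block (`mem_szSector_two_mul_zero_iff`), and `Δ_d φ = 0` gives
  `Δ_dᴴ Δ_d φ = 0`.

Sources: T. Kato, *Perturbation Theory for Linear Operators* (1966), Ch. II §2.3 Thm 2.3;
H. Tasaki (2020) §2.2 (sector spectral theory).  No new definitions.
-/

set_option linter.dupNamespace false

noncomputable section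

namespace Summit.HubbardSuperconductivity.HubbardSuperconductivity.Theorems

open Matrix Complex Module.End
open Literature.MathematicalPhysics.QuantumLattice
open scoped ComplexOrder

section Sector

variable {ι : Type*} [Fintype ι]

/-- **The pointwise Zeno limit in an invariant coordinate sector.** `A`, `Q` Hermitian and
block-preserving for a coordinate subspace `K = {v | v i = 0 unless p i}`; if for all `y ≥ Y`
every eigenvector of `A + i y Q` lying in `K` has eigenvalue of real part `≥ m₀`, then
`m₀ ≤ Re ⟨φ, A φ⟩` for every unit `φ ∈ K` with `Q φ = 0` (restrict to the block `Subtype p` by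
extension-by-zero, as in `sector_groundState`, and apply `re_rayleigh_ge_of_shelf`). [folklore] -/
theorem re_rayleigh_ge_of_shelf_sector (A Q : Matrix ι ι ℂ) (hA : A.IsHermitian)
    (hQ : Q.IsHermitian) (p : ι → Prop) [DecidablePred p]
    (hinvA : ∀ i j, ¬ p i → p j → A i j = 0) (hinvQ : ∀ i j, ¬ p i → p j → Q i j = 0)
    (K : Submodule ℂ (ι → ℂ)) (hK : ∀ v, v ∈ K ↔ ∀ i, ¬ p i → v i = 0) (m₀ Y : ℝ)
    (hshelf : ∀ y : ℝ, Y ≤ y → ∀ φ ∈ K, φ ≠ 0 → ∀ lam : ℂ,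
      (A + (Complex.I * (y : ℂ)) • Q) *ᵥ φ = lam • φ → m₀ ≤ lam.re)
    (φ : ι → ℂ) (hφ : φ ∈ K) (hφ1 : star φ ⬝ᵥ φ = 1) (hQφ : Q *ᵥ φ = 0) :
    m₀ ≤ (star φ ⬝ᵥ A *ᵥ φ).re := by
  classical
  set B : Matrix (Subtype p) (Subtype p) ℂ := A.submatrix Subtype.val Subtype.val with hB
  set Qs : Matrix (Subtype p) (Subtype p) ℂ := Q.submatrix Subtype.val Subtype.val with hQs
  have hBh : B.IsHermitian := hA.submatrix _
  have hQsh : Qs.IsHermitian := hQ.submatrix _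
  -- extension by zero and restriction (as in `sector_groundState`)
  set ext : (Subtype p → ℂ) → (ι → ℂ) := fun w i => if h : p i then w ⟨i, h⟩ else 0 with hext
  set res : (ι → ℂ) → (Subtype p → ℂ) := fun v a => v a.1 with hres
  have hext_apply : ∀ w (a : Subtype p), ext w a.1 = w a := fun w a => by simp [hext, a.2]
  have hext_not : ∀ w i, ¬ p i → ext w i = 0 := fun w i hi => by simp [hext, hi]
  have hres_ext : ∀ w, res (ext w) = w := fun w => funext fun a => hext_apply w a
  have hext_res : ∀ v ∈ K, ext (res v) = v := by
    intro v hv; funext i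
    by_cases hi : p i
    · exact hext_apply (res v) ⟨i, hi⟩
    · rw [hext_not _ i hi, ((hK v).1 hv) i hi]
  have hext_mem : ∀ w, ext w ∈ K := fun w => (hK _).2 fun i hi => hext_not w i hi
  have hext_smul : ∀ (c : ℂ) w, ext (c • w) = c • ext w := by
    intro c w; funext i; by_cases hi : p i <;> simp [hext, hi]
  have hMext : ∀ M : Matrix ι ι ℂ, (∀ i j, ¬ p i → p j → M i j = 0) →
      ∀ w, M *ᵥ ext w = ext (M.submatrix Subtype.val Subtype.val *ᵥ w) := by
    intro M hinv w; funext i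
    rw [mulVec, dotProduct]
    by_cases hi : p i
    · have h1 : ext (M.submatrix Subtype.val Subtype.val *ᵥ w) i =
          (M.submatrix Subtype.val Subtype.val *ᵥ w) ⟨i, hi⟩ := hext_apply _ ⟨i, hi⟩
      rw [h1, mulVec, dotProduct,
        sum_eq_sum_subtype_of_support p (fun j => M i j * ext w j)
          (fun j hj => by rw [hext_not w j hj, mul_zero])]
      refine Finset.sum_congr rfl fun a _ => ?_
      rw [hext_apply]; rfl
    · rw [hext_not _ i hi]
      refine Finset.sum_eq_zero fun j _ => ?_
      by_cases hj : p j
      · rw [hinv i j hi hj, zero_mul]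
      · rw [hext_not w j hj, mul_zero]
  have hdot : ∀ w (z : ι → ℂ), star (ext w) ⬝ᵥ z = star w ⬝ᵥ res z := by
    intro w z
    rw [dotProduct, dotProduct,
      sum_eq_sum_subtype_of_support p (fun j => star (ext w) j * z j)
        (fun j hj => by rw [Pi.star_apply, hext_not w j hj, star_zero, zero_mul])]
    refine Finset.sum_congr rfl fun a _ => ?_
    rw [Pi.star_apply, Pi.star_apply, hext_apply]
  -- the transported shelf hypothesis
  have hshelf' : ∀ y : ℝ, Y ≤ y → ∀ w : Subtype p → ℂ, w ≠ 0 → ∀ lam : ℂ,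
      (B + (Complex.I * (y : ℂ)) • Qs) *ᵥ w = lam • w → m₀ ≤ lam.re := by
    intro y hy w hw lam heq
    have hinvM : ∀ i j, ¬ p i → p j → (A + (Complex.I * (y : ℂ)) • Q) i j = 0 := by
      intro i j hi hj
      simp [hinvA i j hi hj, hinvQ i j hi hj]
    have h1 := hMext _ hinvM w
    have hsub : (A + (Complex.I * (y : ℂ)) • Q).submatrix Subtype.val Subtype.val =
        B + (Complex.I * (y : ℂ)) • Qs := by
      simp [hB, hQs, submatrix_add, submatrix_smul]
    rw [hsub, heq, hext_smul] at h1
    have hne : ext w ≠ 0 := by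
      intro h0
      apply hw
      rw [← hres_ext w, h0]
      rfl
    exact hshelf y hy (ext w) (hext_mem w) hne lam h1
  -- the conclusion for `res φ`
  have hv1 : star (res φ) ⬝ᵥ res φ = 1 := by
    rw [← hφ1]
    conv_rhs => rw [← hext_res φ hφ, hdot, hres_ext]
  have hQv : Qs *ᵥ res φ = 0 := by
    have h1 := hMext Q hinvQ (res φ)
    rw [hext_res φ hφ, hQφ] at h1
    have h2 := congrArg res h1
    rw [hres_ext] at h2
    rw [← h2]
    rfl
  have hcore := Literature.Analysis.Matrix.re_rayleigh_ge_of_shelf B Qs hBh hQsh m₀ Y hshelf' (res φ) hv1 hQv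
  conv_rhs => rw [← hext_res φ hφ, hMext A hinvA, hdot, hres_ext]
  exact hcore

end Sector

/-- **`KkShelfNeedsVacuumGap`** (route `KkFloor`, item `stmt-HubbardSuperconductivity-10409`, the
pointwise Zeno limit): at fixed `(U, δ, ε, Y, L)`, if every sector eigenvalue of
`H_L + i y L⁻² Δ_dᴴ Δ_d` has real part `≥ E₀(L) + ε L²` for all `y ≥ Y`, then every normalised
sector vector `φ` with `Δ_d φ = 0` has `Re ⟨φ, H_L φ⟩ ≥ E₀(L) + ε L²`. Proof: `H_L` and
`Π_L = L⁻² Δ_dᴴ Δ_d` are Hermitian and `(N↑,N↓)`-block diagonal (`PreservesSectors`), the joint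
sector `szSector (2n) 0` is the `(n,n)` coordinate block (`mem_szSector_two_mul_zero_iff`), and
`Π_L φ = 0`; apply `re_rayleigh_ge_of_shelf_sector`, i.e. Kato's first-order reduction at the
semisimple eigenvalue `0` of the Hermitian `Π_L|_sector` (T. Kato (1966) Thm II-2.3,
`Literature.Analysis.Matrix.Kato1966_II_thm_2_3_holds`). [cite: Kato1966, Thm II-2.3] -/
theorem kkShelfNeedsVacuumGap_proof :
    Summit.HubbardSuperconductivity.HubbardSuperconductivity.Theses.KkFloor.KkShelfNeedsVacuumGap := by
  intro U δ ε Y L _ hshelf φ hφ hφ1 hΔφ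
  classical
  set n : ℕ := ⌊(1 - δ) * (L : ℝ) ^ 2 / 2⌋₊ with hn
  set H := hubbardTorus 2 L 1 U with hH
  set Δ := pairField dWaveFormFactor L with hΔ
  set c : ℂ := (((1 : ℝ) / (L : ℝ) ^ 2 : ℝ) : ℂ) with hc
  set Qm : Matrix _ _ ℂ := c • (Δᴴ * Δ) with hQm
  -- the sector predicate
  set p : Finset (Orb (FermionTorus 2 L)) → Prop :=
    fun s => (upPart s).card = n ∧ (downPart s).card = n with hp
  have hKp : ∀ v : Fock (Orb (FermionTorus 2 L)),
      v ∈ szSector (Λ := FermionTorus 2 L) (2 * n) (0 : ℝ) ↔ ∀ s, ¬ p s → v s = 0 :=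
    fun v => mem_szSector_two_mul_zero_iff n v
  -- Hermiticity and sector preservation
  have hHh : H.IsHermitian := LiebThm1.hamiltonian_isHermitian _ 1 U
  have hQ0h : (Δᴴ * Δ).IsHermitian :=
    (Summit.HubbardSuperconductivity.TwTipContinuation.Negative.pairIntensity_posSemidef L).isHermitian
  have hQh : Qm.IsHermitian := by
    unfold Matrix.IsHermitian
    rw [hQm, conjTranspose_smul, hQ0h.eq, hc, Complex.star_def, Complex.conj_ofReal]
  have hpresH : PreservesSectors H := LiebThm1.preservesSectors_hamiltonian (fermionTorusGraph 2 L) 1 U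
  have hpresQ : PreservesSectors Qm :=
    (Summit.HubbardSuperconductivity.TwTipContinuation.Negative.preservesSectors_pairIntensity L).smul c
  have hinv_of : ∀ {M : Matrix _ _ ℂ}, PreservesSectors M → ∀ s s', ¬ p s → p s' → M s s' = 0 := by
    intro M hM s s' hs hs'
    by_contra h
    have := hM s s' h
    exact hs ⟨this.1.trans hs'.1, this.2.trans hs'.2⟩
  have hQφ : Qm *ᵥ φ = 0 := by
    rw [hQm, smul_mulVec, ← mulVec_mulVec, hΔφ, mulVec_zero, smul_zero]
  exact re_rayleigh_ge_of_shelf_sector H Qm hHh hQh p (hinv_of hpresH) (hinv_of hpresQ)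
    (szSector (2 * n) 0) hKp _ Y hshelf φ hφ hφ1 hQφ

end Summit.HubbardSuperconductivity.HubbardSuperconductivity.Theorems
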